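import Summits.ResolutionOfSingularities.ResolutionOfSingularities.Theorems.PurelyInseparableDim4IsoSpineTheorem
import Summits.ResolutionOfSingularities.ResolutionOfSingularities.Theorems.PurelyInseparableDim4IsolatedScope
import Summits.ResolutionOfSingularities.ResolutionOfSingularities.Theorems.PurelyInseparableDim4Perm2BoundOrigin
import Literature.AlgebraicGeometry.Resolution.PointBlowupKangaroo
import HarnessLib
import HarnessLib.Audit.Tags

/-!
# Purely inseparable four-folds — ISO-SPINE-PO, part III: the FRAME form
# (no infinite chart-origin branch of point-only — in particular of ISOLATED — `q`-fold states)
# [OURS · counted 0 · cell res-dim4-pi · idea-3's card I-3-4 (statements) · p-9 (proofs)]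

Sequel of `PurelyInseparableDim4IsoSpine.lean` / `…IsoSpineTheorem.lean` (T(n,q) on supports).  Here
the class of record `n = 4` in the cell's frame (`PurelyInseparableDim4Target`: `PIDim4.State`,
`IsPermissibleCentre`; `CentreBlowup.step`): the three `Prop`s of res-dim4-idea-3's
`IsoSpineSketch.lean` §2 VERBATIM (`PointOnlyF`, `OriginEdge`, `NoPointOnlySpineBranchF`) and

* §2 the support dictionary at the chart ORIGIN: the exponent law of `CentreBlowup.chartExponent q univ j`
  IS `IsoSpine.spineMove q j` on coefficient functions (`coe_chartExponent_univ`); the support of the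
  cleaned transform at `b = 0` lies in the image of the support (`translate 0 = id`, cleaning deletes,
  `Perm2Bound.exists_of_mem_support_chartTransform` — p-2, p646720); `q ≤ ord_{univ}` is `Legal`;
  `PointOnlyF` is `PointOnly` (test the hyperplane centres `S = univ ∖ {k}`);
* §3 **`noPointOnlySpineBranchF : ∀ q, NoPointOnlySpineBranchF q`** (every field, every `q`), from
  `IsoSpine.noPointOnlySpineBranch 4 q`;
* §4 the census corollary for frame v4 TIER 1 (I): an ISOLATED `q`-fold point is point-only
  (`pointOnlyF_of_isIsolated`, via p-12's `IsolatedScope.eq_univ_of_isIsolated`, p648209), hence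
  **`no_isolated_origin_branch`** — the SPINE HALF of F4-I `PIDim4.NoIsolatedTrap p q` for EVERY `p`,
  `q`: an infinite `Step0`-branch of isolated states, if any, contains infinitely many TRANSLATED
  (`b ≠ 0`) edges (`exists_translated_of_isolated_branch`-type reading left to the census; here the
  plain statement «no all-origin isolated branch»).

Nothing in this file is a statement about resolution of singularities; resolution in dimension ≥ 4 /
characteristic `p` is NOT proved anywhere in this programme; counted 0; AI formalisation, weaker than
expert review.  bears_on: LADDER-RESOLUTION:D157-DOOR2 (res-dim4-pi · ISO-SPINE-PO).
Supports stmt-ResolutionOfSingularities-16155 (helper).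
-/

set_option linter.dupNamespace false

noncomputable section

open MvPolynomial Finset

namespace Summit.ResolutionOfSingularities.ResolutionOfSingularities.Theorems.PIDim4.IsoSpine

open Literature.AlgebraicGeometry.Resolution
open Literature.AlgebraicGeometry.Resolution.Hauser2010
open Literature.AlgebraicGeometry.Resolution.CentreBlowup

/-! ## 1. The statements (res-dim4-idea-3, `IsoSpineSketch.lean` §2, verbatim) -/

/-- point-only permissibility of a residual polynomial in the frame's terms. [folklore] -/
def PointOnlyF {K : Type} [Field K] (q : ℕ) (F : MvPolynomial (Fin 4) K) : Prop :=
  ∀ S : Finset (Fin 4), S ≠ Finset.univ → ¬ IsPermissibleCentre q S F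

/-- chart-origin point blow-up edge (`b = 0`), as in the Scope add-on's `SpineEdge q univ`.
[cite: HauserPerlega2019PRIMS, §2 (the blowup in the x₁-chart)] -/
def OriginEdge {K : Type} [Field K] [DecidableEq K] (q : ℕ) (s s' : State K) : Prop :=
  ∃ j : Fin 4, CentreBlowup.IsEquimultiplePoint q Finset.univ j (0 : Fin 4 → K) s ∧
    s' = CentreBlowup.step q Finset.univ j (0 : Fin 4 → K) s

/-- **ISO-SPINE-PO (frame form)**: no infinite chart-origin branch of `q`-fold point-only states — in
particular none of ISOLATED states (`IsIsolated ⇒ PointOnlyF`), for every field and every `q ≥ 1`.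
[folklore] -/
def NoPointOnlySpineBranchF (q : ℕ) : Prop :=
  ∀ (K : Type) [Field K] [DecidableEq K],
    ¬ ∃ c : ℕ → State K, ∀ k, (q : ℕ∞) ≤ CentreBlowup.ordAlong Finset.univ (c k).F ∧
        PointOnlyF q (c k).F ∧ OriginEdge q (c k) (c (k + 1))

/-! ## 2. The support dictionary at the chart origin -/

section Dictionary

variable {K : Type} [Field K]

/-- The exponent law of the point blow-up in the chart `j` IS `spineMove q j` on coefficient
functions. [cite: HauserPerlega2019PRIMS, §2 (the blowup in the x₁-chart)] -/
theorem coe_chartExponent_univ (q : ℕ) (j : Fin 4) (d : Fin 4 →₀ ℕ) :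
    ⇑(CentreBlowup.chartExponent q Finset.univ j d) = spineMove q j ⇑d := by
  unfold CentreBlowup.chartExponent spineMove
  rw [Finsupp.coe_update, degIn_univ, Finsupp.degree_eq_sum]

/-- The coefficient functions of the support of `F`, a position of the support game. [folklore] -/
theorem mem_image_coe_iff (F : MvPolynomial (Fin 4) K) (a : Fin 4 → ℕ) :
    a ∈ F.support.image (fun d : Fin 4 →₀ ℕ => (⇑d : Fin 4 → ℕ)) ↔
      Finsupp.equivFunOnFinite.symm a ∈ F.support := by
  rw [Finset.mem_image]
  constructor
  · rintro ⟨d, hd, rfl⟩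
    have : Finsupp.equivFunOnFinite.symm (⇑d) = d := Finsupp.ext fun i => rfl
    rwa [this]
  · intro h
    exact ⟨_, h, rfl⟩

/-- `q ≤ ord_{univ} F` makes the support a LEGAL position. [folklore] -/
theorem legal_of_le_ordAlong {q : ℕ} {F : MvPolynomial (Fin 4) K}
    (h : (q : ℕ∞) ≤ CentreBlowup.ordAlong Finset.univ F) :
    Legal q (F.support.image fun d : Fin 4 →₀ ℕ => (⇑d : Fin 4 → ℕ)) := by
  intro a ha
  obtain ⟨d, hd, rfl⟩ := Finset.mem_image.mp ha
  have h1 := (le_ordAlong_iff.mp h) d hd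
  rw [degIn_univ, Finsupp.degree_eq_sum] at h1
  exact_mod_cast h1

/-- `PointOnlyF` makes the support a POINT-ONLY position (test the hyperplane centres
`V(z, x_i : i ≠ k)`). [folklore] -/
theorem pointOnly_of_pointOnlyF {q : ℕ} {F : MvPolynomial (Fin 4) K} (h : PointOnlyF q F) :
    PointOnly q (F.support.image fun d : Fin 4 →₀ ℕ => (⇑d : Fin 4 → ℕ)) := by
  intro k
  have hS : Finset.univ.erase k ≠ (Finset.univ : Finset (Fin 4)) := fun hE => by
    have := hE ▸ Finset.notMem_erase k Finset.univ
    exact this (Finset.mem_univ k)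
  have hne : (Finset.univ.erase k : Finset (Fin 4)).Nonempty := by
    refine ⟨k + 1, Finset.mem_erase.mpr ⟨?_, Finset.mem_univ _⟩⟩
    intro hk
    have := congrArg Fin.val hk
    simp [Fin.val_add] at this
    omega
  have hnot := h _ hS
  unfold IsPermissibleCentre at hnot
  rw [not_and, le_ordAlong_iff] at hnot
  have hnot' := hnot hne
  push Not at hnot'
  obtain ⟨d, hd, hlt⟩ := hnot'
  refine ⟨⇑d, Finset.mem_image_of_mem _ hd, ?_⟩
  have hdeg := Perm2Bound.degIn_eq_add_degIn_erase (Finset.mem_univ k) d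
  rw [degIn_univ, Finsupp.degree_eq_sum] at hdeg
  have hlt' : degIn (Finset.univ.erase k) d < q := by exact_mod_cast hlt
  omega

variable [DecidableEq K]

/-- **The support of a chart-origin step lies in the moved support**: cleaning deletes, `translate 0`
is the identity, and the chart transform moves exponents by `chartExponent`. [folklore] -/
theorem support_step_origin_subset (q : ℕ) (j : Fin 4) (s : State K) :
    ((CentreBlowup.step q Finset.univ j (0 : Fin 4 → K) s).F.support.image
        fun d : Fin 4 →₀ ℕ => (⇑d : Fin 4 → ℕ)) ⊆
      (s.F.support.image fun d : Fin 4 →₀ ℕ => (⇑d : Fin 4 → ℕ)).image (spineMove q j) := by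
  intro a ha
  obtain ⟨E, hE, rfl⟩ := Finset.mem_image.mp ha
  change E ∈ (deletePthPowers q (PointBlowup.translate (0 : Fin 4 → K)
    (CentreBlowup.chartTransform q Finset.univ j s.F))).support at hE
  rw [PointBlowup.translate_zero, MvPolynomial.mem_support_iff, coeff_deletePthPowers] at hE
  have hE' : E ∈ (CentreBlowup.chartTransform q Finset.univ j s.F).support := by
    rw [MvPolynomial.mem_support_iff]
    intro h0
    rw [h0, ite_self] at hE
    exact hE rfl
  obtain ⟨e, he, rfl⟩ := Perm2Bound.exists_of_mem_support_chartTransform q Finset.univ j s.F hE'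
  rw [Finset.image_image]
  exact Finset.mem_image.mpr ⟨e, he, (coe_chartExponent_univ q j e).symm⟩

end Dictionary

/-! ## 3. The frame theorem -/

/-- **ISO-SPINE-PO, frame form** (res-dim4-idea-3, memo §3 Corollary; every field, every `q`): there
is no infinite chart-origin branch of `q`-fold point-only states of the class `(4,1)`.  From
`IsoSpine.noPointOnlySpineBranch 4 q` through the support dictionary of §2. [folklore] -/
theorem noPointOnlySpineBranchF (q : ℕ) : NoPointOnlySpineBranchF q := by
  intro K _ _
  rintro ⟨c, hc⟩
  have hj : ∀ k, ∃ j : Fin 4, c (k + 1) = CentreBlowup.step q Finset.univ j (0 : Fin 4 → K) (c k) :=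
    fun k => by
      obtain ⟨j, -, hj⟩ := (hc k).2.2
      exact ⟨j, hj⟩
  choose j hj using hj
  refine noPointOnlySpineBranch 4 q
    ⟨fun k => (c k).F.support.image fun d : Fin 4 →₀ ℕ => (⇑d : Fin 4 → ℕ), j, fun k => ?_⟩
  refine ⟨legal_of_le_ordAlong (hc k).1, pointOnly_of_pointOnlyF (hc k).2.1, ?_⟩
  show ((c (k + 1)).F.support.image fun d : Fin 4 →₀ ℕ => (⇑d : Fin 4 → ℕ)) ⊆
    ((c k).F.support.image fun d : Fin 4 →₀ ℕ => (⇑d : Fin 4 → ℕ)).image (spineMove q (j k))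
  rw [hj k]
  exact support_step_origin_subset q (j k) (c k)

/-! ## 4. The ISOLATED regime: the spine half of F4-I -/

section Isolated

variable {K : Type} [Field K]

/-- **An isolated `q`-fold point is point-only**: at an ISOLATED state (`PIDim4.IsIsolated`, Scope
add-on) no proper coordinate centre is Hironaka-permissible (p-12's `IsolatedScope.eq_univ_of_isIsolated`).
[folklore] -/
theorem pointOnlyF_of_isIsolated {q : ℕ} {F : MvPolynomial (Fin 4) K} (hiso : IsIsolated q F) :
    PointOnlyF q F := fun _ hS hperm => hS (IsolatedScope.eq_univ_of_isIsolated hiso hperm.2)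

variable [DecidableEq K]

/-- A chart-origin `Step0` edge is an `OriginEdge`. [folklore] -/
theorem originEdge_of_edge_univ_zero {q : ℕ} {s s' : State K} {j : Fin 4}
    (heq : CentreBlowup.IsEquimultiplePoint q Finset.univ j (0 : Fin 4 → K) s)
    (hs : s' = CentreBlowup.step q Finset.univ j (0 : Fin 4 → K) s) : OriginEdge q s s' :=
  ⟨j, heq, hs⟩

/-- **The SPINE HALF of F4-I, every `q`, every field**: there is no infinite branch of chart-ORIGIN
point blow-ups all of whose states are ISOLATED `q`-fold points.  (So an infinite `Step0`-branch of
isolated states — the object `PIDim4.NoIsolatedTrap` forbids — would have to contain infinitely many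
TRANSLATED edges; those are the domain of census card I-3-2's colength `μ⁺`.) [folklore] -/
theorem no_isolated_origin_branch (q : ℕ) (K : Type) [Field K] [DecidableEq K] :
    ¬ ∃ c : ℕ → State K, ∀ k, IsIsolated q (c k).F ∧
        (q : ℕ∞) ≤ CentreBlowup.ordAlong Finset.univ (c k).F ∧ OriginEdge q (c k) (c (k + 1)) := by
  rintro ⟨c, hc⟩
  exact noPointOnlySpineBranchF q K
    ⟨c, fun k => ⟨(hc k).2.1, pointOnlyF_of_isIsolated (hc k).1, (hc k).2.2⟩⟩

/-- The same with the `q`-fold clause read off `IsIsolated` itself (`J_q⁺(F) ≤ 𝔪₀ ↔ q ≤ ord₀ F` for a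
polynomial without constant term, p-12's `singLocusIdeal_le_originIdeal_iff_le_ordAlong_univ`): no
infinite chart-origin branch of isolated states with `F(0) = 0`. [folklore] -/
theorem no_isolated_origin_branch' (q : ℕ) (K : Type) [Field K] [DecidableEq K] :
    ¬ ∃ c : ℕ → State K, ∀ k, IsIsolated q (c k).F ∧ coeff 0 (c k).F = 0 ∧
        OriginEdge q (c k) (c (k + 1)) := by
  rintro ⟨c, hc⟩
  refine no_isolated_origin_branch q K ⟨c, fun k => ⟨(hc k).1, ?_, (hc k).2.2⟩⟩
  exact (IsolatedScope.singLocusIdeal_le_originIdeal_iff_le_ordAlong_univ (hc k).2.1).mp (hc k).1.1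

end Isolated

end Summit.ResolutionOfSingularities.ResolutionOfSingularities.Theorems.PIDim4.IsoSpine

end
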